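import Summits.AtomisticToContinuum.Crystallization.Theorems.ChartedZeroExcessLayeredLatticeLiouvilleT

/-!
# Zero-excess layered lattice Liouville — part TB (lens-2 g32, node «MultiScaleHarmonicApprox», continuation of part T): the node currencies
(`IsGlobalReg`, `wildMass`, `bondEnergy`, `tailForce`, `FarDualSmall`), the four pieces (A0) `GlobalChartRegistrationP`, (A1) `WildReRegistrationPG`
(THE RESIDUAL), (A2) `TameHarmonicApproxP`, (FF) `TailForceSlavingP`, the glue `harmonicApproxPGLms_of_four_pieces` (PROVED, THIN/FAT case split) and
the columns `_16XH6`, `_16XH6r`, `_16XH6A`.  The design rationale (multi-scale re-typing, why (A1) is a re-registration, glue constants, why each piece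
is strictly smaller than the node) is in part T's module docstring.  Split from part T only for the gate's 400-line rule.
0 EQUIV; 0 sorry; no instance / notation / set_option.
-/

noncomputable section

open scoped BigOperators InnerProductSpace RealInnerProductSpace
open MeasureTheory Set Metric Filter Topology
open Summit.AtomisticToContinuum.Crystallization.Theorems.ChartedPlanarOrderRigidityDoor
  (E3 IsClean IsNash IsCharted IsEStarGSC VisibleGap PertRegime atomsIn siteEnergy eStar BindingSurface)
open Summit.AtomisticToContinuum.Crystallization.Theorems.ChartedPlanarOrderDensityDichotomy (μS IsSep nK nK_nonneg excess)
open Summit.AtomisticToContinuum.Crystallization.Theorems.ChartedPlanarOrderMesoCut (IsDoorSet NearHom LayeredHom EnvClose)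
open Summit.AtomisticToContinuum.Crystallization.Theorems.OverbindingBudgetLiouvilleDictionary (NearHomBD)
open Summit.AtomisticToContinuum.Crystallization.Theorems.ChartedPlanarOrderDoorLayered
  (TwoPeriodic DoorPeriodic PeriodicBulkGapDoor gap_and_pert_1_50_of_periodic NearHomL2BD nearHomL2BD_mono nearHomBD_of_nearHomL2BD
   sq_le_finsum_mem not_nearHomL2BD_singleton envClose_mono Layered layeredHom_eq_layered atomsIn_subset)
open Summit.AtomisticToContinuum.Crystallization.Theorems.ChartedPlanarOrderDoorLayeredOsc (IsTwoShellAffineGood DoorPeriodicOsc)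
open Summit.AtomisticToContinuum.Crystallization.Theorems.ChartedPlanarOrderCleanScaleP
  (IsCleanP IsDoorSetP DoorPeriodicP isDoorSetP_mono doorPeriodic_of_doorPeriodicP isDoorSetP_one_iff doorPeriodicP_one_iff)
open Summit.AtomisticToContinuum.Crystallization.Theorems.ChartedPlanarOrderProfileSlavingLJ (pairForce)
open Literature.MathematicalPhysics.StatisticalMechanics (haggLabel barlowOffset layerNormal IsHaggSeq triangularVec₁ triangularVec₂)

namespace Summit.AtomisticToContinuum.Crystallization.Theorems.ChartedZeroExcessLayeredLatticeLiouville

/-! ## §V.3  Node currencies (definition requests of this node): global registration, wild mass, bond energy, tail force, dual smallness -/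

/-- ★ **GLOBAL graph registration at scale `R` with constant `Cg` and level `η`** of the configuration `S` to the model set `H` by `Ψ`: `Ψ` is a
BIJECTION `S → H` (hole-free, no tears anywhere), two-sided tear-free at `4 ↦ 8` (Euclidean `4`-neighbours ↦ model `8`-neighbours and conversely), and
at EVERY scale `D ≥ R` the restriction to `win D` is a registration of part Q (`IsRegistered`: two-sided `EnvClose`, domination of bond distortions,
gradient level and position level) at level `Cg·(D/R)·η` — linear growth in `D/R` (what cross-scale chart drift `≤ j·C√η` per dyadic step affords with
room to spare; any growth `o((D/R)³)` keeps the tail sums of (FF) convergent). [this file, g32] -/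
def IsGlobalReg (Cg η R : ℝ) (S H : Set E3) (Ψ : E3 → E3) : Prop :=
  Set.BijOn Ψ S H ∧
    (∀ x ∈ S, ∀ p ∈ S, dist p x ≤ 4 → dist (Ψ p) (Ψ x) ≤ 8) ∧ (∀ x ∈ S, ∀ p ∈ S, dist (Ψ p) (Ψ x) ≤ 4 → dist p x ≤ 8) ∧
    ∀ D : ℝ, R ≤ D → ∃ τ : E3 → ℝ, IsRegistered (Cg * (D / R) * η) 4 D S (atomsIn (μS S) 0 D) H Ψ τ

/-- ★ **wild mass at threshold `ϑ`** of the registration `Ψ` on the chunk `Q`: the squared bond distortions `‖(p − x) − (Ψ p − Ψ x)‖²` of the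
`4`-bonds `(x, p)` of `Q` whose distortion is `≥ ϑ` (BOND-based, not profile-based: an inflated profile cannot manufacture wild mass). [this file, g32] -/
def wildMass (ϑ : ℝ) (Q : Set E3) (Ψ : E3 → E3) : ℝ :=
  ∑ᶠ x ∈ Q, ∑ᶠ p ∈ Q ∩ closedBall x 4, if ϑ ≤ dist (p - x) (Ψ p - Ψ x) then dist (p - x) (Ψ p - Ψ x) ^ 2 else 0

/-- the discrete Dirichlet (bond) energy of a test field `φ` on the chunk `Q` (`4`-bonds). [this file, g32] -/
def bondEnergy (Q : Set E3) (φ : E3 → E3) : ℝ :=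
  ∑ᶠ x ∈ Q, ∑ᶠ p ∈ Q ∩ closedBall x 4, ‖φ p - φ x‖ ^ 2

/-- ★ **the tail force at the atom `x`** (range `ϱ`, registration `Ψ : S → H`): the LJ force on `x` from all atoms `y` whose images are model-farther
than `ϱ` from `Ψ x`, MINUS the LJ force on the model site `Ψ x` from all model sites farther than `ϱ` — i.e. everything that the `ϱ`-truncated
linearisation around the chart (`IsTruncHarmonic`, `forceConst` on `H ∩ closedBall · ϱ`) does not see.  Both sums converge absolutely for separated
`S` and clean `H` (`‖pairForce z‖ ≤ ‖z‖⁻¹³ + ‖z‖⁻⁷`, tree `norm_pairForce_le`). [this file, g32] -/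
def tailForce (ϱ : ℝ) (S H : Set E3) (Ψ : E3 → E3) (x : E3) : E3 :=
  (∑' y : {y : E3 // y ∈ S ∧ ϱ < dist (Ψ y) (Ψ x)}, pairForce (x - (y : E3))) -
    ∑' q : {q : E3 // q ∈ H ∧ ϱ < dist q (Ψ x)}, pairForce (Ψ x - (q : E3))

/-- ★ **dual smallness of the tail force** at `(εf, ϱ, η, R)`: against every test field `φ` supported on the half window `win (R/2)`, the work of the
tail force is `≤ εf · √(η·nK(win R)) · √(bondEnergy (win R) φ)` — the `H⁻¹`-type norm in which (A2)'s energy identity consumes it. [this file, g32] -/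
def FarDualSmall (εf ϱ η R : ℝ) (S H : Set E3) (Ψ : E3 → E3) : Prop :=
  ∀ φ : E3 → E3, (∀ x : E3, x ∉ atomsIn (μS S) 0 (R / 2) → φ x = 0) →
    |∑ᶠ x ∈ atomsIn (μS S) 0 (R / 2), ⟪tailForce ϱ S H Ψ x, φ x⟫_ℝ| ≤
      εf * Real.sqrt (η * nK (atomsIn (μS S) 0 R)) * Real.sqrt (bondEnergy (atomsIn (μS S) 0 R) φ)

/-- ★ **THIN windows have no wild bonds (PROVED)**: if a registration of part Q on a finite chunk has total profile mass `κ·nK Q < ϑ²`, every bond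
distortion is `≤ τ x ≤ √(Σ τ²) < ϑ`, so the `ϑ`-wild mass VANISHES — the thin half of the structural dichotomy, used by the glue to bypass (A1) on thin
windows. [this file, g32] -/
theorem wildMass_eq_zero_of_registered {κ ρ ϑ : ℝ} {S Q H : Set E3} {Ψ : E3 → E3} {τ : E3 → ℝ}
    (hreg : IsRegistered κ 4 ρ S Q H Ψ τ) (hQ : Q.Finite) (hϑ : 0 < ϑ) (hκ : κ * nK Q < ϑ ^ 2) : wildMass ϑ Q Ψ = 0 := by
  obtain ⟨-, -, -, hdom, hsum, -⟩ := hreg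
  refine finsum_mem_of_eqOn_zero fun x hx => ?_
  have hτx : τ x < ϑ := by
    have h1 : τ x ^ 2 < ϑ ^ 2 := (sq_le_finsum_mem hQ τ hx).trans_lt (hsum.trans_lt hκ)
    exact (le_abs_self (τ x)).trans_lt (abs_lt_of_sq_lt_sq h1 hϑ.le)
  refine finsum_mem_of_eqOn_zero fun p hp => ?_
  have hd : dist (p - x) (Ψ p - Ψ x) < ϑ := (hdom x hx p hp.1 (mem_closedBall.1 hp.2)).trans_lt hτx
  show (if ϑ ≤ dist (p - x) (Ψ p - Ψ x) then dist (p - x) (Ψ p - Ψ x) ^ 2 else 0) = 0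
  rw [if_neg (not_le.2 hd)]

/-! ## §V.4  The four pieces beneath (Ams) -/

/-- ★ **(A0) «GlobalChartRegistrationP aHi Λ θ s»** — GLOBAL CHART REGISTRATION, GSC-FREE BY TYPE (door `IsDoorSetP`): for every `δ, a` there are
`Cg ≥ 1`, a ceiling and a floor such that «registered at EVERY scale `D ≥ R` (level `η`, equilibrium `s`-chart per scale) ⇒ ONE equilibrium `s`-chart
`(L, w)` and ONE global registration `Ψ` with `IsGlobalReg Cg η R S (LayeredHom L w) Ψ`».  Mechanism: the door `IsCharted` is a GLOBAL bond-graph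
isomorphism of `S` with a Barlow stacking (no dislocations, vacancies, interstitials or grain boundaries are possible in a door set), so take `w :=` S's own
Hägg word with EQUILIBRIUM heights/registries under `L :=` the scale-`R` chart's linear part (conformal tolerance inherited), `Ψ :=` the graph isomorphism;
tear-freeness both ways from cleanliness of `S` and of the chart (graph distance ≍ Euclidean distance); the level at scale `D`: on tame sites of the
scale-`D` registration `Ψ` agrees with it up to the model-to-model map, whose affine part drifts by `≤ C√η` per dyadic step (two charts registering the
same window at levels `η`, `8η` have `|L − L'| ≤ C√η` — affine-fit RIGIDITY), whence `Σ_{win D} τ² ≤ C(1 + log²(D/R))·η·nK ≤ Cg·(D/R)·η·nK`; on wild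
sites `|δξ| ≤ 2.3 ≤ (2.3/c₀)·τ`.  REGISTRATION (graph)-type; WEAKER THAN (Ams) (never produces a harmonic field or a defect) · TRUE-type · ATTACKABLE·M.
Why it might fail: equilibrium heights must exist for EVERY Hägg word inside the `s`-conformal slice with the homogeneous state clean AND single-site Nash
(expected by interlayer-stiffness domination, `(2γ)⁻⁶/γ⁻⁶ = 1/64`; census (g0) has fcc/hcp/dhcp/9R only), and the affine-fit rigidity constant must be
uniform in the word.
Sources: [this tree: `IsCharted` (RigidityDoor), `RegistrationP` (part Q), `hasSum_pairForce_of_isNash`], [kruzik2019 p.55 Thm 1.1.12 (FJM rigidity)],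
[Theil2006 §3], [EMing2006 §2 (multilattice equilibria)]. [this file, g32] -/
def GlobalChartRegistrationP (aHi Λ θ s : ℝ) : Prop :=
  ∀ δ : ℝ, 0 < δ → ∀ a : ℝ, 0 < a → ∃ Cg : ℝ, 1 ≤ Cg ∧ ∃ η₁ : ℝ, 0 < η₁ ∧ ∃ R₁ : ℝ, 0 < R₁ ∧
    ∀ S : Set E3, IsDoorSetP aHi δ S → (∀ q ∈ S, IsTwoShellAffineGood θ S q) →
      ∀ η : ℝ, 0 < η → η ≤ η₁ → ∀ R : ℝ, R₁ ≤ R →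
        (∀ D : ℝ, R ≤ D → NearHomH1BDE a s Λ η 4 D S (atomsIn (μS S) 0 D)) →
          ∃ (L : E3 ≃L[ℝ] E3) (w : ℤ → E3), IsEquilChart a s Λ L w ∧
            ∃ Ψ : E3 → E3, IsGlobalReg Cg η R S (LayeredHom (L : E3 →L[ℝ] E3) w) Ψ

/-- ★★ **(A1) «WildReRegistrationPG aHi Λ θ s»** — ε-REGULARITY OF THE BAD SET, THE ONE NAMED RESIDUAL OF THIS COLUMN (door `IsDoorSetPG`: needs
e⋆-GSC): for every `δ, a, Cg` there is `Cg' ≥ Cg` (depending on these ONLY) such that for EVERY threshold `ϑ > 0`, EVERY fraction `εw > 0` and EVERY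
fatness `K₀ > 0` (ceiling/floor depending on them): «a FAT window (`K₀ ≤ η·nK(win R)`) of a θ-good GSC door set, globally registered at `(Cg, η, R)` to an
equilibrium chart, can be RE-REGISTERED to the same chart at `(Cg', η, R)` so that the `ϑ`-wild `4`-bonds carry `≤ εw·η·nK(win R)`».  This is the
«misfit carried by O(1)-distorted bonds is `o(η·#)`» clause of part R's (A) docstring, isolated: hot spots (bounded clusters of O(1) bond distortion)
must not carry a fixed fraction of the flatness budget of a near-flat GSC window.  RE-REGISTRATION because over ALL registrations the claim is false
(neighbour swaps, file docstring).  ε-REGULARITY-type; UNDECIDED · TRUE-type-expected · RESIDUAL · IDEA-NEEDED (L).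
Why it might fail: a positive density (`~η`) of bounded, topologically trivial, single-site-Nash hot spots — coherent micro-nuclei of a competing
local structure (Bain-type strain) or frustrated stacking kinks — each individually compatible with e⋆-GSC because its excess is below the interface
cost of removing it; then `wildMass ϑ ≈ η·nK` on fat windows and `εw ↛ 0`.
Sources: [giaquinta1984 Ch. IV (partial regularity, the bad set)], [Evans1986 (quasiconvexity ε-regularity)], [Theil2006 §4], [FlatleyTheil2015
(LJ crystallization, local minimality)], [census TAG 174 (a⁗) pending]. [this file, g32] -/
def WildReRegistrationPG (aHi Λ θ s : ℝ) : Prop :=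
  ∀ δ : ℝ, 0 < δ → ∀ a : ℝ, 0 < a → ∀ Cg : ℝ, 1 ≤ Cg → ∃ Cg' : ℝ, Cg ≤ Cg' ∧
    ∀ ϑ : ℝ, 0 < ϑ → ∀ εw : ℝ, 0 < εw → ∀ K₀ : ℝ, 0 < K₀ → ∃ η₁ : ℝ, 0 < η₁ ∧ ∃ R₁ : ℝ, 0 < R₁ ∧
      ∀ S : Set E3, IsDoorSetPG aHi δ S → (∀ q ∈ S, IsTwoShellAffineGood θ S q) →
        ∀ η : ℝ, 0 < η → η ≤ η₁ → ∀ R : ℝ, R₁ ≤ R →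
          ∀ (L : E3 ≃L[ℝ] E3) (w : ℤ → E3), IsEquilChart a s Λ L w →
            ∀ Ψ : E3 → E3, IsGlobalReg Cg η R S (LayeredHom (L : E3 →L[ℝ] E3) w) Ψ →
              K₀ ≤ η * nK (atomsIn (μS S) 0 R) →
                ∃ Ψ' : E3 → E3, IsGlobalReg Cg' η R S (LayeredHom (L : E3 →L[ℝ] E3) w) Ψ' ∧
                  wildMass ϑ (atomsIn (μS S) 0 R) Ψ' ≤ εw * η * nK (atomsIn (μS S) 0 R)

/-- **the TAME RADIUS `ϑ₀ := 1/20`** — a DEFINED constant of the Lennard-Jones potential `V(r) = r⁻¹²/12 − r⁻⁶/6` of `pairForce`: a `4`-bond of a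
`θ`-good window (`θ = 1/16`) whose displacement distortion is `< 2ϑ₀` keeps its length in `(1 − θ − 2ϑ₀, ∞) ⊂ (0.8, ∞)`, where all derivatives of the
pair force are bounded by absolute constants (uniform second-order Taylor remainder `|g_e| ≤ C|δu_e|²` — the «tame» bonds of the linearisation), and a
nearest-neighbour bond stays inside the radial-convexity region `r⁶ < 13/7` of `V` (`V'' = 13r⁻¹⁴ − 7r⁻⁸`).  Certificates `tameRadius_taylor`,
`tameRadius_convex` below. [this file, g32] -/
def tameRadius : ℝ := 1 / 20

/-- `0 < ϑ₀`. [folklore] -/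
theorem tameRadius_pos : 0 < tameRadius := by norm_num [tameRadius]

/-- certificate: tame bonds of a `1/16`-good window have length `> 4/5`. -/
theorem tameRadius_taylor : (4 : ℝ) / 5 < 1 - 1 / 16 - 2 * tameRadius := by norm_num [tameRadius]

/-- certificate: a nearest-neighbour bond distorted by `< 2ϑ₀` stays radially convex for `V_LJ` (`(1 + 2ϑ₀)⁶ < 13/7`). -/
theorem tameRadius_convex : (1 + 2 * tameRadius) ^ 6 < (13 : ℝ) / 7 := by norm_num [tameRadius]

/-- ★★ **(R_W) «WildFractionPG aHi Λ θ s»** — THE NAMED RESIDUAL AT THE TAME RADIUS = (A1) with the threshold FIXED to the potential constant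
`ϑ₀ := tameRadius` (so only the fraction `εw` and the fatness `K₀` stay universally quantified, and `(η₁, R₁)` come after them): «a FAT window of a θ-good
GSC door set, globally registered at `(Cg, η, R)` to an equilibrium chart, can be RE-REGISTERED at `(Cg', η, R)` so that the `ϑ₀`-wild `4`-bonds carry
`≤ εw·η·nK(win R)`».  It is the FIRST RUNG of (A1) (PROVED: `wildFractionPG_of_wildReRegistrationPG`) and the DECLARED INPUT of the sub-threshold
content that (A1) `∀ϑ` carries beyond it (Meyers-type higher integrability of the linearised problem below `ϑ₀`) and of the tree leaf (C)
«CaccioppoliPGL» (part Q), whose GSC energy comparison silently needs exactly this wild-bond sparsity on fat windows; architecture (II) of the critic's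
row 536 (part TC of this node) consumes (R_W) — not (A1) — in its position-level Caccioppoli step (C♭).  ε-REGULARITY-type; UNDECIDED · TRUE-type-expected
· RESIDUAL · IDEA-NEEDED (L); no layer beneath it before census TAG 174 (a⁗).
Why it might fail: as (A1) — a positive density of bounded, single-site-Nash, e⋆-GSC-compatible hot spots (coherent micro-nuclei / frustrated stacking
kinks) on near-flat fat windows would pin `wildMass ϑ₀ ≈ η·nK`; fixing `ϑ = ϑ₀` removes only the sub-threshold (higher-integrability) part of (A1).
Sources: [giaquinta1984 Ch. IV], [Evans1986], [Beck2016 Lemma 4.27, p.118 (galaxy:pdf:8146166563808928060)], [FlatleyTheil2015], [Theil2006 §4],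
[census TAG 174 (a⁗) pending]. [this file, g32] -/
def WildFractionPG (aHi Λ θ s : ℝ) : Prop :=
  ∀ δ : ℝ, 0 < δ → ∀ a : ℝ, 0 < a → ∀ Cg : ℝ, 1 ≤ Cg → ∃ Cg' : ℝ, Cg ≤ Cg' ∧
    ∀ εw : ℝ, 0 < εw → ∀ K₀ : ℝ, 0 < K₀ → ∃ η₁ : ℝ, 0 < η₁ ∧ ∃ R₁ : ℝ, 0 < R₁ ∧
      ∀ S : Set E3, IsDoorSetPG aHi δ S → (∀ q ∈ S, IsTwoShellAffineGood θ S q) →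
        ∀ η : ℝ, 0 < η → η ≤ η₁ → ∀ R : ℝ, R₁ ≤ R →
          ∀ (L : E3 ≃L[ℝ] E3) (w : ℤ → E3), IsEquilChart a s Λ L w →
            ∀ Ψ : E3 → E3, IsGlobalReg Cg η R S (LayeredHom (L : E3 →L[ℝ] E3) w) Ψ →
              K₀ ≤ η * nK (atomsIn (μS S) 0 R) →
                ∃ Ψ' : E3 → E3, IsGlobalReg Cg' η R S (LayeredHom (L : E3 →L[ℝ] E3) w) Ψ' ∧
                  wildMass tameRadius (atomsIn (μS S) 0 R) Ψ' ≤ εw * η * nK (atomsIn (μS S) 0 R)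

/-- seam: (A1) ⇒ (R_W) — the residual at the tame radius is the `ϑ := ϑ₀` instance of the bad-set ε-regularity (PROVED). [this file, g32] -/
theorem wildFractionPG_of_wildReRegistrationPG {aHi Λ θ s : ℝ} (h : WildReRegistrationPG aHi Λ θ s) : WildFractionPG aHi Λ θ s := by
  intro δ hδ a ha Cg hCg
  obtain ⟨Cg', hCg', h'⟩ := h δ hδ a ha Cg hCg
  exact ⟨Cg', hCg', fun εw hεw K₀ hK₀ => h' tameRadius tameRadius_pos εw hεw K₀ hK₀⟩

/-- ★ **(A2) «TameHarmonicApproxP aHi Λ θ s»** — THE LINEAR STEP, GSC-FREE BY TYPE (door `IsDoorSetP`; single-site Nash force balance is the TREE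
theorem `hasSum_pairForce_of_isNash`): given (T) and (U), for every `δ, a, Cg` and every shrink factor `M ≥ 64` there is `C ≥ 1` (depending on these
ONLY) such that for every defect target `c'` and range floor `ϱ₁` there are a wildness threshold `ϑ`, a wild fraction `εw`, a tail tolerance `εf` and
a range floor `ϱ₂ ≥ ϱ₁` with, for EVERY range `ϱ ≥ ϱ₂` (ceiling/floor depending on it): «globally registered at `(Cg, η, R)` to an equilibrium `s`-chart
`H`, `ϑ`-wild mass `≤ εw·η·nK(win R)`, tail force `εf`-dual-small ⇒ the root window at `R/M` SPLITS (`IsHarmSplit ϱ (C·η) (c'·η) 4 (R/M)`) with the SAME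
chart and registration».  Mechanism: `h :=` the `K_ϱ`-harmonic extension of `u ∘ Ψ⁻¹` on `Ψ(win (R/2))` (exists and is unique: coercive by (U) − (T)
for `ϱ ≥ ϱ₂(κ₀)`); energy identity for `w := u∘Ψ⁻¹ − h` (vanishing outside): `κ‖δw‖² ≤ |⟨G_tay, w⟩| + |⟨tailForce, w⟩|`; tame bonds `|g_e| ≤ C|δu_e|²
≤ Cϑ|δu_e|` ⇒ `≤ Cϑ²·Cg·η·nK/κ²`; wild bonds `|g_e| ≤ C|δu_e|` ⇒ `≤ C(εw + √(εw·Cg))·η·nK/κ`; tail `≤ εf²·η·nK/κ²`; choose `ϑ, εw, εf` from `c'/(M³)`;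
level of `h` on the `8ρ`-ball `≤ ‖δh‖²_{Ψ(win R/2)} ≤ C·Cg·η·nK(win R) = C·M³·…·nK(win ρ)` (density bounds of clean sets) — NO interior estimate needed
since `M` is a parameter; tear-free and `InjOn/MapsTo` clauses restricted from `IsGlobalReg`; `8ρ + ϱ ≤ R/2` inside the image by `M ≥ 64`, `R ≥ R₁(ϱ)`.
LINEARISATION-type; WEAKER THAN (Ams) (sparsity and tail smallness are typed hypotheses) · TRUE-type · ATTACKABLE·M–L.
Why it might fail: the identification of `Σ forceConst`-truncated linearisation with the exact force balance needs the Hessian of the CHART at its own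
sites to be the `layeredKernel` of (U)/(T) (one cut convention, physical bond length — as ruled D-g30-1 (2)); a mismatch of conventions between
`IsTruncHarmonic` (closed model ball `ϱ`) and (T) (strict `ϱ <`) is harmless but must be tracked; long tame bonds accumulate distortion `≤ Σ_path |δ|`.
Sources: [giaquinta1984 p.120 Thm 3.1 (harmonic replacement, energy identity)], [EMing2006 §4 (Cauchy–Born linearisation)], [Theil2006 §4],
[OrtnerTheil2013 (consistency of atomistic linearisation)], [this tree: `hasSum_pairForce_of_isNash`, `forceConst`, `IsTruncHarmonic`]. [this file, g32] -/
def TameHarmonicApproxP (aHi Λ θ s : ℝ) : Prop :=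
  TailDominationCert → UniformEquilStability s Λ →
    ∀ δ : ℝ, 0 < δ → ∀ a : ℝ, 0 < a → ∀ Cg : ℝ, 1 ≤ Cg → ∀ M : ℝ, 64 ≤ M → ∃ C : ℝ, 1 ≤ C ∧
      ∀ c' : ℝ, 0 < c' → ∀ ϱ₁ : ℝ, 1 ≤ ϱ₁ →
        ∃ ϑ : ℝ, 0 < ϑ ∧ ∃ εw : ℝ, 0 < εw ∧ ∃ εf : ℝ, 0 < εf ∧ ∃ ϱ₂ : ℝ, ϱ₁ ≤ ϱ₂ ∧ ∀ ϱ : ℝ, ϱ₂ ≤ ϱ →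
          ∃ η₁ : ℝ, 0 < η₁ ∧ ∃ R₁ : ℝ, 0 < R₁ ∧
            ∀ S : Set E3, IsDoorSetP aHi δ S → (∀ q ∈ S, IsTwoShellAffineGood θ S q) →
              ∀ η : ℝ, 0 < η → η ≤ η₁ → ∀ R : ℝ, R₁ ≤ R →
                ∀ (L : E3 ≃L[ℝ] E3) (w : ℤ → E3), IsEquilChart a s Λ L w →
                  ∀ Ψ : E3 → E3, IsGlobalReg Cg η R S (LayeredHom (L : E3 →L[ℝ] E3) w) Ψ →
                    wildMass ϑ (atomsIn (μS S) 0 R) Ψ ≤ εw * η * nK (atomsIn (μS S) 0 R) →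
                      FarDualSmall εf ϱ η R S (LayeredHom (L : E3 →L[ℝ] E3) w) Ψ →
                        ∃ (h : E3 → E3) (σ τ : E3 → ℝ),
                          IsHarmSplit ϱ (C * η) (c' * η) 4 (R / M) S (LayeredHom (L : E3 →L[ℝ] E3) w) Ψ h σ τ

/-- ★ **(FF) «TailForceSlavingP aHi Λ θ s»** — THE TAIL FORCE IS SLAVED UNDER GLOBAL REGISTRATION, GSC-FREE AND MINIMALITY-FREE BY TYPE (door
`IsDoorSetP`; pure LJ lattice-sum analysis): for every `δ, a, Cg` and every tolerance `εf > 0` there is a range floor `ϱ₀ ≥ 1` such that for EVERY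
range `ϱ ≥ ϱ₀` (ceiling/floor depending on it): «globally registered at `(Cg, η, R)` to an equilibrium `s`-chart ⇒ `FarDualSmall εf ϱ η R`».
Mechanism: pair the far atom `y` with its image `q = Ψ y` (bijection); per pair, LINEAR part `∇²V(q − Ψx)(ξ_q − ξ_x)` and Taylor remainder with
`|r| ≤ C D⁻⁸ |ξ_q − ξ_x|` (both gradients bounded); Newton's third law makes BOTH antisymmetric in `(x, q)`, so `⟨tailForce, φ⟩ = ½ Σ_pairs (…)(φ_x − φ_q)`
and Cauchy–Schwarz gives `≤ (Σ D⁻⁸|Δξ|²)^{1/2} (Σ D⁻⁸|Δφ|²)^{1/2}`: in-window shells `ϱ < D ≤ R` contribute `ε_T(ϱ)·√(2Cg·η·nK(win 2R))·‖δφ‖`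
(`ε_T(ϱ) ~ ϱ^{-3/2}`, discrete Poincaré along bond paths), the exterior `D > R` contributes `C√η·‖δφ‖` in TOTAL (dyadic shells `D⁻⁸·D³`, levels
`Cg·(D/R)·η`, Poincaré for the drift of means `|ξ̄_D − ξ̄_R| ≤ C√η D^{3/2}R^{-1/2}`, discrete Hardy `Σ|φ|²/d² ≤ C‖δφ‖²` for the one-sided pairs) —
`≤ εf·√(η·nK(win R))·‖δφ‖` once `ε_T(ϱ)√(16Cg) ≤ εf/2` and `nK(win R) ≥ 4C²/εf²`.  The chart's FICTITIOUS far layers match S's true far layers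
because (A0) gave the chart S's own word, and height mismatches are the slaved strain `√η·D`.  LJ-LATTICE-SUM-type; WEAKER THAN (Ams) · TRUE-type ·
ATTACKABLE·M.  This is where `Literature.Barriers.AtomisticToContinuum.LocalizedPotentialsExcludeLennardJones` is DISCHARGED for the A-side: the
`r⁻⁶` tail is summed, not truncated (`Σ_{D>ϱ} D²·D⁻⁸ < ∞`).
Why it might fail: only bookkeeping — summability of both `tsum`s (separation of `S`, cleanliness of `H`) must be proved so that `tailForce` is the true
tail and not a junk value; the exterior Poincaré step needs `win D` bond-connected (door sets are: charted + clean).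
Sources: [this tree: `pairForce`, `norm_pairForce_le`, `hasSum_pairForce_of_isNash`, `TailDominationCert`], [Theil2006 §4 (lattice sums)],
[Schmidt2009/BlancLeBrisLions2002 (atomistic-to-continuum tails)], [EMing2006]. [this file, g32] -/
def TailForceSlavingP (aHi Λ θ s : ℝ) : Prop :=
  ∀ δ : ℝ, 0 < δ → ∀ a : ℝ, 0 < a → ∀ Cg : ℝ, 1 ≤ Cg → ∀ εf : ℝ, 0 < εf → ∃ ϱ₀ : ℝ, 1 ≤ ϱ₀ ∧ ∀ ϱ : ℝ, ϱ₀ ≤ ϱ →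
    ∃ η₁ : ℝ, 0 < η₁ ∧ ∃ R₁ : ℝ, 0 < R₁ ∧
      ∀ S : Set E3, IsDoorSetP aHi δ S → (∀ q ∈ S, IsTwoShellAffineGood θ S q) →
        ∀ η : ℝ, 0 < η → η ≤ η₁ → ∀ R : ℝ, R₁ ≤ R →
          ∀ (L : E3 ≃L[ℝ] E3) (w : ℤ → E3), IsEquilChart a s Λ L w →
            ∀ Ψ : E3 → E3, IsGlobalReg Cg η R S (LayeredHom (L : E3 →L[ℝ] E3) w) Ψ →
              FarDualSmall εf ϱ η R S (LayeredHom (L : E3 →L[ℝ] E3) w) Ψ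

/-! ## §V.5  ★★★ The glue: (Ams) ⟸ (A0) ∧ (A1) ∧ (A2) ∧ (FF) — PROVED (THIN/FAT case split + threading of constants) -/

/-- ★★★ **(Ams)(aHi;Λ,θ,s) ⟸ (A0) ∧ (A1) ∧ (A2) ∧ (FF) (PROVED)** — constants as in the file docstring («GLUE CONSTANTS»); per `(S, η, R)`:
(A0) gives `(L, w, Ψ)`; THIN (`η·nK(win R) < K₀ := ϑ_t²/(2Cg)`) ⇒ `wildMass ϑ_t = 0` (`wildMass_eq_zero_of_registered`) ⇒ (FF) + (A2) at `Cg`;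
FAT ⇒ (A1) re-registers to `Ψ'` ⇒ (FF) + (A2) at `Cg'`; levels merged by `IsHarmSplit.mono` (`C := max C_t C_f`), `M := 64`. [this file, g32] -/
theorem harmonicApproxPGLms_of_four_pieces {aHi Λ θ s : ℝ} (h0 : GlobalChartRegistrationP aHi Λ θ s) (h1 : WildReRegistrationPG aHi Λ θ s)
    (h2 : TameHarmonicApproxP aHi Λ θ s) (hF : TailForceSlavingP aHi Λ θ s) : HarmonicApproxPGLms aHi Λ θ s := by
  intro hT hU _hL δ hδ a ha
  obtain ⟨Cg, hCg, η0, hη0, R0, hR0, h0'⟩ := h0 δ hδ a ha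
  obtain ⟨Cg', hCg', h1'⟩ := h1 δ hδ a ha Cg hCg
  have hCg'1 : 1 ≤ Cg' := hCg.trans hCg'
  have hCg0 : 0 < Cg := zero_lt_one.trans_le hCg
  obtain ⟨Ct, hCt, h2t⟩ := h2 hT hU δ hδ a ha Cg hCg 64 le_rfl
  obtain ⟨Cf, hCf, h2f⟩ := h2 hT hU δ hδ a ha Cg' hCg'1 64 le_rfl
  refine ⟨max Ct Cf, le_max_of_le_left hCt, fun c' hc' ϱ₁ hϱ₁ => ?_⟩
  obtain ⟨ϑt, hϑt, εwt, hεwt, εft, hεft, ϱ₂t, hϱ₂t, h2t'⟩ := h2t c' hc' ϱ₁ hϱ₁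
  obtain ⟨ϑf, hϑf, εwf, hεwf, εff, hεff, ϱ₂f, hϱ₂f, h2f'⟩ := h2f c' hc' ϱ₁ hϱ₁
  obtain ⟨ϱ₀t, hϱ₀t, hFt⟩ := hF δ hδ a ha Cg hCg εft hεft
  obtain ⟨ϱ₀f, hϱ₀f, hFf⟩ := hF δ hδ a ha Cg' hCg'1 εff hεff
  -- the common range
  set ϱ : ℝ := max (max ϱ₂t ϱ₂f) (max ϱ₀t ϱ₀f) with hϱdef
  have hϱt : ϱ₂t ≤ ϱ := (le_max_left _ _).trans (le_max_left _ _)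
  have hϱf : ϱ₂f ≤ ϱ := (le_max_right _ _).trans (le_max_left _ _)
  have hϱ0t : ϱ₀t ≤ ϱ := (le_max_left _ _).trans (le_max_right _ _)
  have hϱ0f : ϱ₀f ≤ ϱ := (le_max_right _ _).trans (le_max_right _ _)
  obtain ⟨ηt, hηt, Rt, hRt, h2t''⟩ := h2t' ϱ hϱt
  obtain ⟨ηf, hηf, Rf, hRf, h2f''⟩ := h2f' ϱ hϱf
  obtain ⟨ηFt, hηFt, RFt, hRFt, hFt'⟩ := hFt ϱ hϱ0t
  obtain ⟨ηFf, hηFf, RFf, hRFf, hFf'⟩ := hFf ϱ hϱ0f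
  -- the fatness threshold and (A1)
  set K₀ : ℝ := ϑt ^ 2 / (2 * Cg) with hK₀def
  have hK₀ : 0 < K₀ := by positivity
  obtain ⟨η1, hη1, R1, hR1, h1''⟩ := h1' ϑf hϑf εwf hεwf K₀ hK₀
  -- ceilings and floors
  refine ⟨ϱ, hϱ₂t.trans hϱt, 64, by norm_num,
    min (min η0 η1) (min (min ηt ηf) (min ηFt ηFf)),
    lt_min (lt_min hη0 hη1) (lt_min (lt_min hηt hηf) (lt_min hηFt hηFf)),
    max (max R0 R1) (max (max Rt Rf) (max RFt RFf)), lt_max_of_lt_left (lt_max_of_lt_left hR0),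
    fun S hSd hg η hη hηle R hR hms => ?_⟩
  have hη0' : η ≤ η0 := hηle.trans ((min_le_left _ _).trans (min_le_left _ _))
  have hη1' : η ≤ η1 := hηle.trans ((min_le_left _ _).trans (min_le_right _ _))
  have hηt' : η ≤ ηt := hηle.trans ((min_le_right _ _).trans ((min_le_left _ _).trans (min_le_left _ _)))
  have hηf' : η ≤ ηf := hηle.trans ((min_le_right _ _).trans ((min_le_left _ _).trans (min_le_right _ _)))
  have hηFt' : η ≤ ηFt := hηle.trans ((min_le_right _ _).trans ((min_le_right _ _).trans (min_le_left _ _)))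
  have hηFf' : η ≤ ηFf := hηle.trans ((min_le_right _ _).trans ((min_le_right _ _).trans (min_le_right _ _)))
  have hR0R : R0 ≤ R := ((le_max_left _ _).trans (le_max_left _ _)).trans hR
  have hR1R : R1 ≤ R := ((le_max_right _ _).trans (le_max_left _ _)).trans hR
  have hRtR : Rt ≤ R := (((le_max_left _ _).trans (le_max_left _ _)).trans (le_max_right _ _)).trans hR
  have hRfR : Rf ≤ R := (((le_max_right _ _).trans (le_max_left _ _)).trans (le_max_right _ _)).trans hR
  have hRFtR : RFt ≤ R := (((le_max_left _ _).trans (le_max_right _ _)).trans (le_max_right _ _)).trans hR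
  have hRFfR : RFf ≤ R := (((le_max_right _ _).trans (le_max_right _ _)).trans (le_max_right _ _)).trans hR
  have hRpos : 0 < R := hR0.trans_le hR0R
  have hfin : (atomsIn (μS S) 0 R).Finite := finite_atomsIn hδ hSd.1.2.1 R
  -- step (A0): one global chart and registration
  obtain ⟨L, w, hE, Ψ, hG⟩ := h0' S hSd.1 hg η hη hη0' R hR0R hms
  rcases lt_or_ge (η * nK (atomsIn (μS S) 0 R)) K₀ with hthin | hfat
  · -- THIN window: no wild bonds at threshold `ϑ_t`; (FF) and (A2) at constant `Cg`
    obtain ⟨τ, hτ⟩ := hG.2.2.2 R le_rfl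
    have hlev : Cg * (R / R) * η * nK (atomsIn (μS S) 0 R) < ϑt ^ 2 := by
      rw [div_self hRpos.ne', mul_one]
      have hK : Cg * K₀ = ϑt ^ 2 / 2 := by
        rw [hK₀def]
        field_simp
      calc Cg * η * nK (atomsIn (μS S) 0 R) = Cg * (η * nK (atomsIn (μS S) 0 R)) := by ring
        _ < Cg * K₀ := mul_lt_mul_of_pos_left hthin hCg0
        _ = ϑt ^ 2 / 2 := hK
        _ ≤ ϑt ^ 2 := by linarith [sq_nonneg ϑt]
    have hW : wildMass ϑt (atomsIn (μS S) 0 R) Ψ ≤ εwt * η * nK (atomsIn (μS S) 0 R) := by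
      rw [wildMass_eq_zero_of_registered hτ hfin hϑt hlev]
      exact mul_nonneg (mul_nonneg hεwt.le hη.le) (nK_nonneg _)
    have hFD := hFt' S hSd.1 hg η hη hηFt' R hRFtR L w hE Ψ hG
    obtain ⟨h, σ, τ', hsplit⟩ := h2t'' S hSd.1 hg η hη hηt' R hRtR L w hE Ψ hG hW hFD
    exact ⟨L, w, hE, Ψ, h, σ, τ', hsplit.mono (mul_le_mul_of_nonneg_right (le_max_left _ _) hη.le) le_rfl⟩
  · -- FAT window: (A1) re-registers; (FF) and (A2) at constant `Cg'`
    obtain ⟨Ψ', hG', hW'⟩ := h1'' S hSd hg η hη hη1' R hR1R L w hE Ψ hG hfat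
    have hFD := hFf' S hSd.1 hg η hη hηFf' R hRFfR L w hE Ψ' hG'
    obtain ⟨h, σ, τ', hsplit⟩ := h2f'' S hSd.1 hg η hη hηf' R hRfR L w hE Ψ' hG' hW' hFD
    exact ⟨L, w, hE, Ψ', h, σ, τ', hsplit.mono (mul_le_mul_of_nonneg_right (le_max_right _ _) hη.le) le_rfl⟩

/-! ## §V.6  ★ Columns of the node (`s = 1/50`, `s' = 1/25`) -/

/-- ★★ **(HDms) ⟸ (T) ∧ (U) ∧ (A0) ∧ (A1) ∧ (A2) ∧ (FF) ∧ (D) (PROVED)**. [this file, g32] -/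
theorem harmonicDecayPGLms_of_seven_pieces {aHi Λ θ s s' : ℝ} (hT : TailDominationCert) (hU : UniformEquilStability s Λ)
    (h0 : GlobalChartRegistrationP aHi Λ θ s) (h1 : WildReRegistrationPG aHi Λ θ s) (h2 : TameHarmonicApproxP aHi Λ θ s)
    (hF : TailForceSlavingP aHi Λ θ s) (hD : SplitDecayPL aHi Λ θ s s') : HarmonicDecayPGLms aHi Λ θ s s' :=
  harmonicDecayPGLms_of_tail_unif_approxms_decay hT hU (harmonicApproxPGLms_of_four_pieces h0 h1 h2 hF) hD

/-- ★★ **H♭^ℓ,ms ⟸ (P) ∧ (T) ∧ (U) ∧ (A0) ∧ (A1) ∧ (A2) ∧ (FF) ∧ (D) ∧ (C) (PROVED)**. [this file, g32] -/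
theorem halvingBasinPGLms_of_nine_pieces {aHi Λ θ s s' : ℝ} (hP : RegistrationP aHi Λ θ s) (hT : TailDominationCert)
    (hU : UniformEquilStability s Λ) (h0 : GlobalChartRegistrationP aHi Λ θ s) (h1 : WildReRegistrationPG aHi Λ θ s)
    (h2 : TameHarmonicApproxP aHi Λ θ s) (hF : TailForceSlavingP aHi Λ θ s) (hD : SplitDecayPL aHi Λ θ s s')
    (hC : CaccioppoliPGL aHi Λ θ s') : HalvingBasinPGLms aHi Λ θ s :=
  halvingBasinPGLms_of_reg_harm_cacc hP (harmonicDecayPGLms_of_seven_pieces hT hU h0 h1 h2 hF hD) hC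

/-- ★★★ **COLUMN `_16XH6` — FIFTEEN opaque leaves, THE COLUMN OF THIS NODE**: `LatticeLiouvilleCert → LayeredLiouvilleCert → R_G(1;2,1/16,1/16) →
X(1;2,1/16,1/16) → Z_E(1;2,1/16,1/50) → P(1;2,1/16,1/50) → T → U(1/50,2) → A0 → A1 → A2 → FF (all at (1;2,1/16,1/50)) → D(1;2,1/16,1/50,1/25) →
C(1;2,1/16,1/25) → PeriodicBulkGapDoor 2 → VisibleGap (1/50) ∧ PertRegime (1/50)`.  Residual: (A1) alone. [this file, g32] -/
theorem gap_and_pert_1_50_of_certs_16XH6 (hL : LatticeLiouvilleCert) (hL' : LayeredLiouvilleCert)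
    (hR : OscRigidityL2BDPG 1 2 (1 / 16) (1 / 16)) (hX : ExcessFlatnessControlP 1 2 (1 / 16) (1 / 16))
    (hE : ExcessChartLocalisationP 1 2 (1 / 16) (1 / 50)) (hP : RegistrationP 1 2 (1 / 16) (1 / 50))
    (hT : TailDominationCert) (hU : UniformEquilStability (1 / 50) 2)
    (h0 : GlobalChartRegistrationP 1 2 (1 / 16) (1 / 50)) (h1 : WildReRegistrationPG 1 2 (1 / 16) (1 / 50))
    (h2 : TameHarmonicApproxP 1 2 (1 / 16) (1 / 50)) (hF : TailForceSlavingP 1 2 (1 / 16) (1 / 50))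
    (hDd : SplitDecayPL 1 2 (1 / 16) (1 / 50) (1 / 25)) (hCc : CaccioppoliPGL 1 2 (1 / 16) (1 / 25))
    (hG : PeriodicBulkGapDoor 2) : VisibleGap (1 / 50) ∧ PertRegime (1 / 50) :=
  gap_and_pert_1_50_of_certs_16XHlms hL hL' hR hX hE (halvingBasinPGLms_of_nine_pieces hP hT hU h0 h1 h2 hF hDd hCc) hG

/-- ★★ **COLUMN `_16XH6r` — SEVENTEEN leaves, (D) resolved into part S's (D₀) ∧ (D₁) ∧ (D₂)**. [this file, g32] -/
theorem gap_and_pert_1_50_of_certs_16XH6r (hL : LatticeLiouvilleCert) (hL' : LayeredLiouvilleCert)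
    (hR : OscRigidityL2BDPG 1 2 (1 / 16) (1 / 16)) (hX : ExcessFlatnessControlP 1 2 (1 / 16) (1 / 16))
    (hE : ExcessChartLocalisationP 1 2 (1 / 16) (1 / 50)) (hP : RegistrationP 1 2 (1 / 16) (1 / 50))
    (hT : TailDominationCert) (hU : UniformEquilStability (1 / 50) 2)
    (h0 : GlobalChartRegistrationP 1 2 (1 / 16) (1 / 50)) (h1 : WildReRegistrationPG 1 2 (1 / 16) (1 / 50))
    (h2 : TameHarmonicApproxP 1 2 (1 / 16) (1 / 50)) (hF : TailForceSlavingP 1 2 (1 / 16) (1 / 50))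
    (hd₀ : TameReindex (1 / 50) 2) (hd₁ : InteriorDecayCert) (hd₂ : ReChartPL 1 2 (1 / 16) (1 / 50) (1 / 25))
    (hCc : CaccioppoliPGL 1 2 (1 / 16) (1 / 25)) (hG : PeriodicBulkGapDoor 2) : VisibleGap (1 / 50) ∧ PertRegime (1 / 50) :=
  gap_and_pert_1_50_of_certs_16XH6 hL hL' hR hX hE hP hT hU h0 h1 h2 hF (splitDecayPL_of_reindex_decay_rechart hd₀ hd₁ hd₂) hCc hG

/-- ★ **COLUMN `_16XH6A` — «nothing lost»: the same column with part R's (A) VERBATIM in place of the four pieces** (via (A) ⇒ (Ams)). [this file, g32] -/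
theorem gap_and_pert_1_50_of_certs_16XH6A (hL : LatticeLiouvilleCert) (hL' : LayeredLiouvilleCert)
    (hR : OscRigidityL2BDPG 1 2 (1 / 16) (1 / 16)) (hX : ExcessFlatnessControlP 1 2 (1 / 16) (1 / 16))
    (hE : ExcessChartLocalisationP 1 2 (1 / 16) (1 / 50)) (hP : RegistrationP 1 2 (1 / 16) (1 / 50))
    (hT : TailDominationCert) (hU : UniformEquilStability (1 / 50) 2) (hA : HarmonicApproxPGL 1 2 (1 / 16) (1 / 50))
    (hDd : SplitDecayPL 1 2 (1 / 16) (1 / 50) (1 / 25)) (hCc : CaccioppoliPGL 1 2 (1 / 16) (1 / 25))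
    (hG : PeriodicBulkGapDoor 2) : VisibleGap (1 / 50) ∧ PertRegime (1 / 50) :=
  gap_and_pert_1_50_of_certs_16XHlms hL hL' hR hX hE
    (halvingBasinPGLms_of_reg_harm_cacc hP
      (harmonicDecayPGLms_of_tail_unif_approxms_decay hT hU (harmonicApproxPGLms_of_harmonicApproxPGL hA) hDd) hCc) hG

end Summit.AtomisticToContinuum.Crystallization.Theorems.ChartedZeroExcessLayeredLatticeLiouville

end
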